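import Summits.BirchSwinnertonDyer.Rank1Residual.ManinAdditive.PlusIndexLaws
import Literature.NumberTheory.EllipticCurves.SkinnerUrban2014.PAdicUnitPeriodRatioProofs
import Mathlib.RingTheory.ZMod.UnitsCyclic
import Mathlib.NumberTheory.LSeries.PrimesInAP
import HarnessLib
import HarnessLib.Audit.Tags

/-!
# LEMMA W and the TOWER UNIT-TWIST LAW E-an-135: E-es-66 ⟸ E-an-135(3), E-es-66₂ ⟸ E-an-135(2) as LEAN THEOREMS

Cell `bsd-f2-manin` (D-0131 (3) frontier), lens `an`, planner an g29 MEMO-an §71.2/§71.4/§71.10, typing ask T-an-33 (UPGRADED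
2026-08-28T20:21:04Z «land VERBATIM»); landed by the cell typer g14 VERBATIM from HOME/an/g29/Sketch-an-g29-thm.lean sha16
22bf37c81e8f28c5 (405 l.; farm rc 0·0·0·0; axioms standard), namespace `BsdF2ManinAnG29T` ↦ `…ManinAdditive.KatoCurve`; an's
`additive_of_four_dvd_level` re-proof / `additive_of_nine_dvd_level` use replaced by ONE cone-free lemma `additive_of_sq_dvd_level p`
(DEDUP + theses-cone hygiene).  Prop bodies VERBATIM those of HOME/an/g29/Sketch-an-g29.lean §0–§3.
HONEST FRAMING.  ONE LAW: **E-an-135 `TowerUnitTwist p`** (single-clause TOWER UNIT-TWIST LAW) is an OBLIGATION NODE tagged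
`@[conjecture]` (schema in `p`; used at `p = 3` (C3) / `p = 2` (C2)); nothing asserted.  EVERYTHING ELSE IS PROVED, sorry-free:
`wieferichLevel_holds : WieferichLevel` (LEMMA W via cyclicity of `(ZMod (q^n))ˣ`, odd `q`; no Hensel), **E-an-136₃
`threeAdicWitness_of_towerUnitTwist : TowerUnitTwist 3 → ThreeAdicWitnessOfPlusIndexPrimeToThree`** (E-es-66 ⟸ E-an-135(3):
Dirichlet prime `q ≡ 2 (3)`, `q > N + 3`; `n₁ := v_q(9^{q-1}-1) + 1`; `m := qⁿ`, `ρ := 1`), **E-an-136₂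
`twoAdicWitness_of_towerUnitTwist : TowerUnitTwist 2 → TwoAdicWitnessOfPlusIndexOdd`**, `towerReductionAt{Three,Two}_holds`.
Open content of E-es-66/66₂ = E-an-135 (⟸ E-an-137, MEMO-an §71.5).  BC5: HOME/an/g29/TOWER-an-g29-p{2,3}{,ctl}.txt; REF1 R-an-51 PENDING
at filing (repairs under NEW names).  TURNKEY-an-16: `h66 := threeAdicWitness_of_towerUnitTwist h135`, `h66₂ := twoAdicWitness_of_towerUnitTwist h135₂`.
bears_on: stmt-BirchSwinnertonDyer-22968 (C3), -22967 (C2).  PARTITION 0 · beyond-print theorem: no (an) · BSD / Manin not proved by this. -/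

set_option autoImplicit false
noncomputable section
open scoped Classical MatrixGroups ModularForm ComplexConjugate

open CongruenceSubgroup Complex WeierstrassCurve Literature.NumberTheory.EllipticCurves
  Literature.NumberTheory.EllipticCurves.ModularForms
  Summit.BirchSwinnertonDyer.Rank1Residual.ManinAdditive
  Summit.BirchSwinnertonDyer.Rank1Residual.ManinAdditive.KatoCurve

namespace Summit.BirchSwinnertonDyer.Rank1Residual.ManinAdditive.KatoCurve

/-- **Lemma W** (MEMO-an §71.2), verbatim `BsdF2ManinAnG29.WieferichLevel`. -/
def WieferichLevel : Prop :=
  ∀ (q x n : ℕ), q.Prime → q ≠ 2 → 1 < x → ¬ q ∣ x → padicValNat q (x ^ (q - 1) - 1) < n →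
    ∀ χ : DirichletCharacter ℂ (q ^ n), χ.IsPrimitive → χ (x : ZMod (q ^ n)) ≠ 1

/-- verbatim `BsdF2ManinAnG29.UnitTwistAt`. -/
def UnitTwistAt (p : ℕ) (V : WeierstrassCurve ℚ) [V.IsElliptic] {N : ℕ} [NeZero N]
    (f : CuspForm (Gamma0 N) 2) {m : ℕ} [NeZero m] (χ : DirichletCharacter ℂ m) : Prop :=
  ∃ r : ℂ,
    (∏ ℓ ∈ N.primeFactors with ¬ ℓ ^ 2 ∣ N,
        (((ℓ : ℂ) - (V.LFunction ℓ : ℂ) * χ (ℓ : ZMod m)) *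
          ((ℓ : ℂ) - (V.LFunction ℓ : ℂ) * (χ (ℓ : ZMod m))⁻¹))) *
        twistedSymbolSum f χ = r * (plusPeriod f : ℂ) ∧
    ∀ s : ℕ, ¬ p ∣ s → ¬ _root_.IsIntegral ℤ ((s : ℂ) * r / p)

/-- **E-an-135 `TowerUnitTwist p` — the single-clause TOWER UNIT-TWIST LAW** (MEMO-an §71.4; verbatim
`BsdF2ManinAnG29.TowerUnitTwist`): for the newform `f` of `W` with plus index prime to `p` and an odd prime `q ≠ p`,
`q ∤ N`, `p ∤ (q−1)/2`, arbitrarily high in the `q`-power conductor tower there is an even primitive `χ` with a `p`-adic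
UNIT twist `UnitTwistAt p W f χ`.  TYPER FRAMING (E-an-135): lens an; LAW (obligation node), nothing asserted; BC5 /
REF1 status in the module docstring.  OPEN in Lean. [conjecture — cell candidate, NOT a tree fact] -/
@[conjecture]
def TowerUnitTwist (p : ℕ) : Prop :=
  ∀ (W : WeierstrassCurve ℚ) [W.IsElliptic] {N : ℕ} [NeZero N] (f : CuspForm (Gamma0 N) 2),
    IsNewformOf W f → PlusIndexPrimeTo p f →
    ∀ (q : ℕ) [Fact q.Prime], q ≠ 2 → q ≠ p → ¬ q ∣ N → ¬ p ∣ (q - 1) / 2 →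
    ∀ n₁ : ℕ, ∃ n : ℕ, n₁ ≤ n ∧
      ∃ χ : DirichletCharacter ℂ (q ^ n), χ.IsPrimitive ∧ χ.Even ∧ UnitTwistAt p W f χ

/-- verbatim `BsdF2ManinAnG29.TowerReductionAtThree` (E-an-136₃). -/
def TowerReductionAtThree : Prop :=
  WieferichLevel → TowerUnitTwist 3 → ThreeAdicWitnessOfPlusIndexPrimeToThree

/-- verbatim `BsdF2ManinAnG29.TowerReductionAtTwo` (E-an-136₂). -/
def TowerReductionAtTwo : Prop :=
  WieferichLevel → TowerUnitTwist 2 → TwoAdicWitnessOfPlusIndexOdd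

/-- In a finite group, a subgroup of prime order `q` inside a group with at most `q` solutions of `a^q = 1`
contains every element of order `q`. (Used with `(ZMod (q^n))ˣ`, cyclic for odd `q`.) -/
theorem mem_of_orderOf_eq_of_card_eq {G : Type*} [Group G] [Fintype G] [IsCyclic G]
    (K : Subgroup G) {q : ℕ} (hq : q.Prime) (hK : Nat.card K = q) {h : G} (hh : orderOf h = q) :
    h ∈ K := by
  classical
  have hKpow : ∀ k ∈ K, k ^ q = 1 := by
    intro k hk
    have h1 := pow_card_eq_one' (G := K) (x := ⟨k, hk⟩)
    rw [hK] at h1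
    simpa using congrArg Subtype.val h1
  set S := Finset.univ.filter (fun a : G => a ^ q = 1) with hS
  set KF := Finset.univ.filter (fun a : G => a ∈ K) with hKF
  have hcount : S.card ≤ q := IsCyclic.card_pow_eq_one_le hq.pos
  have hKFcard : KF.card = q := by
    have e : {a : G // a ∈ K} ≃ {a : G // a ∈ KF} :=
      Equiv.subtypeEquivRight (fun a => by simp [hKF])
    have h1 : Nat.card {a : G // a ∈ KF} = KF.card := Nat.card_eq_finsetCard KF
    rw [← h1, ← Nat.card_congr e]
    exact hK
  have hsub : KF ⊆ S := by
    intro a ha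
    simp only [hKF, hS, Finset.mem_filter, Finset.mem_univ, true_and] at ha ⊢
    exact hKpow a ha
  have heq : KF = S := Finset.eq_of_subset_of_card_le hsub (by rw [hKFcard]; exact hcount)
  have hmemS : h ∈ S := by
    simp only [hS, Finset.mem_filter, Finset.mem_univ, true_and]
    rw [← hh]; exact pow_orderOf_eq_one h
  rw [← heq] at hmemS
  simpa [hKF] using hmemS

/-- **LEMMA W** (MEMO-an §71.2) — PROVED. -/
theorem wieferichLevel_holds : WieferichLevel := by
  intro q x n hq hq2 hx hqx hs χ hprim
  classical
  haveI hqF : Fact q.Prime := ⟨hq⟩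
  haveI : NeZero (q ^ n) := ⟨pow_ne_zero n hq.ne_zero⟩
  have hq3 : 3 ≤ q := by have := hq.two_le; omega
  have hn : 0 < n := by omega
  have hxpow : 1 < x ^ (q - 1) := Nat.one_lt_pow (by omega) hx
  have hne : x ^ (q - 1) - 1 ≠ 0 := by omega
  have hcop : Nat.Coprime x (q ^ n) :=
    Nat.Coprime.pow_right n ((Nat.Prime.coprime_iff_not_dvd hq).2 hqx).symm
  set u : (ZMod (q ^ n))ˣ := ZMod.unitOfCoprime x hcop with hu
  have hu_val : (u : ZMod (q ^ n)) = (x : ZMod (q ^ n)) := ZMod.coe_unitOfCoprime x hcop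
  intro hχx
  have hker_u : χ.toUnitHom u = 1 := by
    apply Units.ext
    rw [MulChar.coe_toUnitHom, hu_val, hχx, Units.val_one]
  have hcardG : Fintype.card (ZMod (q ^ n))ˣ = q ^ (n - 1) * (q - 1) := by
    rw [ZMod.card_units_eq_totient, Nat.totient_prime_pow hq hn]
  -- Step A: `q ∣ ord u`, from the Wieferich-level hypothesis.
  have hq_dvd_ord : q ∣ orderOf u := by
    by_contra hnd
    have hcopr : Nat.Coprime (orderOf u) (q ^ (n - 1)) :=
      Nat.Coprime.pow_right _ ((Nat.Prime.coprime_iff_not_dvd hq).2 hnd).symm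
    have hdvd : orderOf u ∣ q ^ (n - 1) * (q - 1) := hcardG ▸ orderOf_dvd_card
    have hdvd' : orderOf u ∣ q - 1 := hcopr.dvd_of_dvd_mul_left hdvd
    have hpow1 : u ^ (q - 1) = 1 := orderOf_dvd_iff_pow_eq_one.1 hdvd'
    have hcast : ((x ^ (q - 1) : ℕ) : ZMod (q ^ n)) = ((1 : ℕ) : ZMod (q ^ n)) := by
      have h1 := congrArg (fun v : (ZMod (q ^ n))ˣ => (v : ZMod (q ^ n))) hpow1
      simp only [Units.val_pow_eq_pow_val, hu_val, Units.val_one] at h1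
      simpa using h1
    rw [ZMod.natCast_eq_natCast_iff] at hcast
    have hmod : q ^ n ∣ x ^ (q - 1) - 1 := (Nat.modEq_iff_dvd' hxpow.le).1 hcast.symm
    have : n ≤ padicValNat q (x ^ (q - 1) - 1) := (padicValNat_dvd_iff_le hne).1 hmod
    omega
  -- Step B: `n ≥ 2` (for `n = 1` the group has order `q - 1`, prime to `q`).
  have hn2 : 2 ≤ n := by
    by_contra hlt
    have hn1 : n = 1 := by omega
    have hdvd : orderOf u ∣ q ^ (n - 1) * (q - 1) := hcardG ▸ orderOf_dvd_card
    have hrew : q ^ (n - 1) * (q - 1) = q - 1 := by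
      have : n - 1 = 0 := by omega
      rw [this, pow_zero, one_mul]
    rw [hrew] at hdvd
    have h1 : q ∣ q - 1 := dvd_trans hq_dvd_ord hdvd
    have := Nat.le_of_dvd (by omega) h1
    omega
  -- Step C: the element `h = u^{ord u / q}` of order `q` lies in `K = ker((ℤ/qⁿ)ˣ → (ℤ/qⁿ⁻¹)ˣ)`, `|K| = q`.
  set h : (ZMod (q ^ n))ˣ := u ^ (orderOf u / q) with hh
  have hordh : orderOf h = q := orderOf_pow_orderOf_div (orderOf_pos u).ne' hq_dvd_ord
  have hh1 : h ≠ 1 := by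
    intro h1; rw [h1, orderOf_one] at hordh; omega
  have hker_h : χ.toUnitHom h = 1 := by rw [hh, map_pow, hker_u, one_pow]
  have hd : q ^ (n - 1) ∣ q ^ n := pow_dvd_pow q (by omega)
  haveI : NeZero (q ^ (n - 1)) := ⟨pow_ne_zero _ hq.ne_zero⟩
  set K := (ZMod.unitsMap hd).ker with hK
  have hcardK : Nat.card K = q := by
    have h1 : Nat.card K * K.index = Nat.card (ZMod (q ^ n))ˣ := K.card_mul_index
    have h2 : K.index = Nat.card (ZMod (q ^ (n - 1)))ˣ := by
      rw [hK, Subgroup.index_ker, MonoidHom.range_eq_top.2 (ZMod.unitsMap_surjective hd),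
        Subgroup.card_top]
    rw [h2, Nat.card_eq_fintype_card (α := (ZMod (q ^ n))ˣ),
      Nat.card_eq_fintype_card (α := (ZMod (q ^ (n - 1)))ˣ), ZMod.card_units_eq_totient,
      ZMod.card_units_eq_totient, Nat.totient_prime_pow hq hn,
      Nat.totient_prime_pow hq (by omega : 0 < n - 1)] at h1
    have hsplit : q ^ (n - 1) * (q - 1) = q * (q ^ (n - 1 - 1) * (q - 1)) := by
      have : q ^ (n - 1) = q * q ^ (n - 1 - 1) := by
        rw [← pow_succ']; congr 1; omega
      rw [this, mul_assoc]
    rw [hsplit] at h1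
    have hpos : 0 < q ^ (n - 1 - 1) * (q - 1) :=
      Nat.mul_pos (pow_pos hq.pos _) (by omega)
    exact Nat.eq_of_mul_eq_mul_right hpos h1
  haveI : IsCyclic (ZMod (q ^ n))ˣ := ZMod.isCyclic_units_of_prime_pow q hq hq2 n
  have hhK : h ∈ K := mem_of_orderOf_eq_of_card_eq K hq hcardK hordh
  -- Step D: `K = ⟨h⟩` (prime order), so `χ` is trivial on `K`.
  have hKle : K ≤ χ.toUnitHom.ker := by
    intro k hk
    have hgen : Subgroup.zpowers (⟨h, hhK⟩ : K) = ⊤ :=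
      zpowers_eq_top_of_prime_card (p := q) hcardK (g := ⟨h, hhK⟩) (by
        intro h1; apply hh1; simpa using congrArg Subtype.val h1)
    have hmem : (⟨k, hk⟩ : K) ∈ Subgroup.zpowers (⟨h, hhK⟩ : K) := by
      rw [hgen]; exact Subgroup.mem_top _
    obtain ⟨z, hz⟩ := Subgroup.mem_zpowers_iff.1 hmem
    have hz' : h ^ z = k := by simpa using congrArg Subtype.val hz
    rw [MonoidHom.mem_ker, ← hz', map_zpow, hker_h, one_zpow]
  -- Step E: `χ` factors through level `qⁿ⁻¹`: contradiction with primitivity.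
  have hfact : χ.FactorsThrough (q ^ (n - 1)) :=
    (DirichletCharacter.factorsThrough_iff_ker_unitsMap (χ := χ) hd).2 hKle
  have hcond : χ.conductor ≤ q ^ (n - 1) :=
    Nat.sInf_le ((DirichletCharacter.mem_conductorSet_iff χ).2 hfact)
  have hc : χ.conductor = q ^ n := hprim
  rw [hc] at hcond
  have : q ^ (n - 1) < q ^ n := Nat.pow_lt_pow_right (by omega) (by omega)
  omega

/-- The order of a Dirichlet character divides `#(ℤ/m)ˣ`. -/
theorem orderOf_dvd_card_units {m : ℕ} [NeZero m] (χ : DirichletCharacter ℂ m) :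
    orderOf χ ∣ Fintype.card (ZMod m)ˣ := by
  apply orderOf_dvd_of_pow_eq_one
  apply MulChar.ext; intro a
  rw [MulChar.pow_apply_coe, ← map_pow, ← Units.val_pow_eq_pow_val, pow_card_eq_one, Units.val_one, map_one,
    MulChar.one_apply_coe]

/-- In the cyclic group `(ℤ/qⁿ)ˣ` (`q` an odd prime, `n ≥ 1`) an element of square `1` is `±1`. -/
theorem sq_eq_one_units {q n : ℕ} (hq : q.Prime) (hq2 : q ≠ 2) (hn : 0 < n) [NeZero (q ^ n)]
    (b : (ZMod (q ^ n))ˣ) (hb : b ^ 2 = 1) : b = 1 ∨ b = -1 := by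
  classical
  haveI : IsCyclic (ZMod (q ^ n))ˣ := ZMod.isCyclic_units_of_prime_pow q hq hq2 n
  by_contra hcon
  push Not at hcon
  have hcount : (Finset.univ.filter (fun a : (ZMod (q ^ n))ˣ => a ^ 2 = 1)).card ≤ 2 :=
    IsCyclic.card_pow_eq_one_le (by norm_num)
  have hq3 : 3 ≤ q := by have := hq.two_le; omega
  haveI : Fact (2 < q ^ n) := ⟨by
    calc 2 < 3 := by norm_num
      _ ≤ q := hq3
      _ = q ^ 1 := (pow_one q).symm
      _ ≤ q ^ n := Nat.pow_le_pow_right hq.pos hn⟩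
  have hne : (1 : (ZMod (q ^ n))ˣ) ≠ -1 := by
    intro h
    have h' := congrArg (fun v : (ZMod (q ^ n))ˣ => (v : ZMod (q ^ n))) h
    simp only [Units.val_neg, Units.val_one] at h'
    exact ZMod.neg_one_ne_one h'.symm
  have h3 : ({1, -1, b} : Finset (ZMod (q ^ n))ˣ) ⊆
      Finset.univ.filter (fun a : (ZMod (q ^ n))ˣ => a ^ 2 = 1) := by
    intro a ha
    simp only [Finset.mem_insert, Finset.mem_singleton] at ha
    simp only [Finset.mem_filter, Finset.mem_univ, true_and]
    rcases ha with rfl | rfl | rfl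
    · exact one_pow 2
    · exact neg_one_sq
    · exact hb
  have hcard3 : ({1, -1, b} : Finset (ZMod (q ^ n))ˣ).card = 3 :=
    Finset.card_eq_three.2 ⟨1, -1, b, hne, fun h => hcon.1 h.symm, fun h => hcon.2 h.symm, rfl⟩
  have := Finset.card_le_card h3
  omega

/-- An EVEN character of conductor dividing `qⁿ`, `q ≡ 3 (mod 4)` prime, has ODD order: it factors through
`(ℤ/qⁿ)ˣ/±1`, of odd order `qⁿ⁻¹(q-1)/2`. -/
theorem orderOf_odd_of_even {q n : ℕ} (hq : q.Prime) (hq2 : q ≠ 2) (hn : 0 < n) (hq4 : ¬ 2 ∣ (q - 1) / 2)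
    [NeZero (q ^ n)] (χ : DirichletCharacter ℂ (q ^ n)) (heven : χ.Even) : ¬ 2 ∣ orderOf χ := by
  classical
  set M := q ^ (n - 1) * ((q - 1) / 2) with hM
  have hqodd : ¬ 2 ∣ q := fun h => by
    rcases hq.eq_one_or_self_of_dvd 2 h with h | h <;> omega
  have hdiv : 2 ∣ q - 1 := by omega
  have hcard : Fintype.card (ZMod (q ^ n))ˣ = 2 * M := by
    rw [ZMod.card_units_eq_totient, Nat.totient_prime_pow hq hn, hM]
    conv_lhs => rw [← Nat.div_mul_cancel hdiv]
    ring
  have hModd : ¬ 2 ∣ M := by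
    rw [hM]; intro h
    rcases (Nat.Prime.dvd_mul Nat.prime_two).1 h with h | h
    · exact hqodd (Nat.Prime.dvd_of_dvd_pow Nat.prime_two h)
    · exact hq4 h
  have hpow : χ ^ M = 1 := by
    apply MulChar.ext; intro a
    rw [MulChar.pow_apply_coe, ← map_pow, ← Units.val_pow_eq_pow_val, MulChar.one_apply_coe]
    have hsq : (a ^ M) ^ 2 = 1 := by
      rw [← pow_mul, mul_comm, ← hcard]; exact pow_card_eq_one
    rcases sq_eq_one_units hq hq2 hn (a ^ M) hsq with h | h
    · rw [h, Units.val_one, map_one]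
    · rw [h, Units.val_neg, Units.val_one]; exact heven
  intro h2
  exact hModd (dvd_trans h2 (orderOf_dvd_of_pow_eq_one hpow))

/-- `p² ∣ N ⟹ additive at p` for the newform's curve, all primes (typer; cone-free twin of the tree's
`additive_of_{four,nine}_dvd_level`: `IsNewformOf.dvd_level_iff_dvd_conductorNorm` + Atkin–Lehner Thm 3). PROVED. -/
theorem additive_of_sq_dvd_level (p : ℕ) [Fact p.Prime]
    (W : WeierstrassCurve ℚ) [W.IsElliptic] {N : ℕ} [NeZero N] (f : CuspForm (Gamma0 N) 2)
    (hf : IsNewformOf W f) (h : p ^ 2 ∣ N) :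
    ¬ W.HasGoodReductionAtPrime p ∧ ¬ W.HasMultiplicativeReductionAtPrime p := by
  have hp : p.Prime := Fact.out
  have hpN : p ∣ N := dvd_trans (dvd_pow_self p two_ne_zero) h
  refine ⟨fun hgood => ?_, fun hmult => ?_⟩
  · have hpc : p ∣ W.conductorNorm ℤ := (hf.dvd_level_iff_dvd_conductorNorm hp).mp hpN
    exact (W.dvd_conductorNorm_iff_not_hasGoodReductionAtPrime p).mp hpc hgood
  · exact SkinnerUrban2014.not_sq_dvd_level_of_hasMultiplicativeReductionAtPrime hmult hf h

/-- **E-an-136₃, PROVED**: the `3`-adic tower law E-an-135(3) implies E-es-66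
(`ThreeAdicWitnessOfPlusIndexPrimeToThree`).  `q` = a Dirichlet prime `≡ 2 (mod 3)` above `N + 3`; level
`n ≥ v_q(9^{q-1}-1) + 1` so that LEMMA W gives `χ(9) ≠ 1`, i.e. `χ(3) ∉ {±1}`; `3 ∤ ord χ ∣ qⁿ⁻¹(q-1)`;
`m := qⁿ`, `ρ := 1`; additivity at `3` from `9 ∣ N` (`additive_of_sq_dvd_level 3`). -/
theorem threeAdicWitness_of_towerUnitTwist (hT : TowerUnitTwist 3) :
    ThreeAdicWitnessOfPlusIndexPrimeToThree := by
  intro W _ _ N _ D hopt h9 hplus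
  classical
  obtain ⟨q, hqgt, hq, hqmod⟩ :=
    Nat.forall_exists_prime_gt_and_modEq (N + 3) (q := 3) (a := 2) (by norm_num) (by norm_num)
  haveI hqF : Fact q.Prime := ⟨hq⟩
  have hNpos : 0 < N := Nat.pos_of_ne_zero (NeZero.ne N)
  have hqN : ¬ q ∣ N := fun h => by have := Nat.le_of_dvd hNpos h; omega
  have hq2 : q ≠ 2 := by omega
  have hq3 : q ≠ 3 := by omega
  have hmod' : q % 3 = 2 := hqmod
  have hqodd : ¬ 2 ∣ q := fun h => by
    rcases hq.eq_one_or_self_of_dvd 2 h with h | h <;> omega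
  have h3q : ¬ 3 ∣ (q - 1) / 2 := by omega
  obtain ⟨n, hn, χ, hprim, heven, r, hr, hunit⟩ :=
    hT W D.f D.isNewformOf hplus q hq2 hq3 hqN h3q (padicValNat q (9 ^ (q - 1) - 1) + 1)
  haveI : NeZero (q ^ n) := ⟨pow_ne_zero n hq.ne_zero⟩
  have hn0 : 0 < n := by omega
  haveI : Fact (Nat.Prime 3) := ⟨Nat.prime_three⟩
  have hadd := additive_of_sq_dvd_level 3 W D.f D.isNewformOf h9
  have hq9 : ¬ q ∣ 9 := by
    intro h
    have h' : q ∣ 3 ^ 2 := by simpa using h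
    have := (Nat.prime_dvd_prime_iff_eq hq Nat.prime_three).1 (hq.dvd_of_dvd_pow h')
    omega
  have hW9 : χ ((9 : ℕ) : ZMod (q ^ n)) ≠ 1 :=
    wieferichLevel_holds q 9 n hq hq2 (by norm_num) hq9 (by omega) χ hprim
  have h9cast : ((9 : ℕ) : ZMod (q ^ n)) = (3 : ZMod (q ^ n)) ^ 2 := by norm_num
  rw [h9cast, map_pow] at hW9
  have hc3a : χ (3 : ZMod (q ^ n)) ≠ 1 := fun h => hW9 (by rw [h, one_pow])
  have hc3b : χ (3 : ZMod (q ^ n)) ≠ -1 := fun h => hW9 (by rw [h, neg_one_sq])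
  have hord : ¬ 3 ∣ orderOf χ := by
    intro h3
    have hdvd := dvd_trans h3 (orderOf_dvd_card_units χ)
    rw [ZMod.card_units_eq_totient, Nat.totient_prime_pow hq hn0] at hdvd
    rcases (Nat.Prime.dvd_mul Nat.prime_three).1 hdvd with h | h
    · have := (Nat.prime_dvd_prime_iff_eq Nat.prime_three hq).1 (Nat.prime_three.dvd_of_dvd_pow h)
      omega
    · omega
  have hcop : (q ^ n).Coprime (3 * N) := by
    apply Nat.Coprime.pow_left
    exact Nat.Coprime.mul_right ((Nat.coprime_primes hq Nat.prime_three).2 hq3)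
      ((Nat.Prime.coprime_iff_not_dvd hq).2 hqN)
  have hne1 : χ ≠ 1 := by
    intro h1
    have hc : χ.conductor = 1 := (DirichletCharacter.eq_one_iff_conductor_eq_one).1 h1
    have hc' : χ.conductor = q ^ n := hprim
    have : 1 < q ^ n := Nat.one_lt_pow (by omega) hq.one_lt
    omega
  refine ⟨q ^ n, inferInstance, χ, r, 1, D.isNewformOf, hadd.1, hadd.2, hcop, hprim, hne1, hord, hc3a, hc3b,
    heven, ?_, hr, ?_⟩
  · simp
  · intro s hs
    simpa using hunit s hs

/-- **E-an-136₂, PROVED**: the `2`-adic tower law E-an-135(2) implies E-es-66₂ (`TwoAdicWitnessOfPlusIndexOdd`).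
`q ≡ 3 (mod 4)` above `N + 3`; `n ≥ v_q(8^{q-1}-1) + 1` (LEMMA W: `χ(8) ≠ 1`); odd order by `orderOf_odd_of_even`;
additivity at `2` from `4 ∣ N`. -/
theorem twoAdicWitness_of_towerUnitTwist (hT : TowerUnitTwist 2) : TwoAdicWitnessOfPlusIndexOdd := by
  intro W _ _ N _ D hopt h4 hplus
  classical
  obtain ⟨q, hqgt, hq, hqmod⟩ :=
    Nat.forall_exists_prime_gt_and_modEq (N + 3) (q := 4) (a := 3) (by norm_num) (by norm_num)
  haveI hqF : Fact q.Prime := ⟨hq⟩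
  have hNpos : 0 < N := Nat.pos_of_ne_zero (NeZero.ne N)
  have hqN : ¬ q ∣ N := fun h => by have := Nat.le_of_dvd hNpos h; omega
  have hq2 : q ≠ 2 := by omega
  have hmod' : q % 4 = 3 := hqmod
  have h2q : ¬ 2 ∣ (q - 1) / 2 := by omega
  obtain ⟨n, hn, χ, hprim, heven, r, hr, hunit⟩ :=
    hT W D.f D.isNewformOf hplus q hq2 hq2 hqN h2q (padicValNat q (8 ^ (q - 1) - 1) + 1)
  haveI : NeZero (q ^ n) := ⟨pow_ne_zero n hq.ne_zero⟩
  have hn0 : 0 < n := by omega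
  haveI : Fact (Nat.Prime 2) := ⟨Nat.prime_two⟩
  have hadd := additive_of_sq_dvd_level 2 W D.f D.isNewformOf h4
  have hq8 : ¬ q ∣ 8 := by
    intro h
    have h' : q ∣ 2 ^ 3 := by simpa using h
    have := (Nat.prime_dvd_prime_iff_eq hq Nat.prime_two).1 (hq.dvd_of_dvd_pow h')
    omega
  have hW8 : χ ((8 : ℕ) : ZMod (q ^ n)) ≠ 1 :=
    wieferichLevel_holds q 8 n hq hq2 (by norm_num) hq8 (by omega) χ hprim
  have hc8 : χ (8 : ZMod (q ^ n)) ≠ 1 := by simpa using hW8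
  have hord : ¬ 2 ∣ orderOf χ := orderOf_odd_of_even hq hq2 hn0 h2q χ heven
  have hcop : (q ^ n).Coprime (2 * N) := by
    apply Nat.Coprime.pow_left
    exact Nat.Coprime.mul_right ((Nat.coprime_primes hq Nat.prime_two).2 hq2)
      ((Nat.Prime.coprime_iff_not_dvd hq).2 hqN)
  have hne1 : χ ≠ 1 := by
    intro h1
    have hc : χ.conductor = 1 := (DirichletCharacter.eq_one_iff_conductor_eq_one).1 h1
    have hc' : χ.conductor = q ^ n := hprim
    have : 1 < q ^ n := Nat.one_lt_pow (by omega) hq.one_lt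
    omega
  refine ⟨q ^ n, inferInstance, χ, r, 1, D.isNewformOf, hadd.1, hadd.2, hcop, hprim, hne1, hord, hc8, ?_, hr, ?_⟩
  · simp
  · intro s hs
    simpa using hunit s hs

/-- E-an-136₃ in the typed shape (`WieferichLevel` is no longer needed as a hypothesis). -/
theorem towerReductionAtThree_holds : TowerReductionAtThree :=
  fun _ hT => threeAdicWitness_of_towerUnitTwist hT

/-- E-an-136₂ in the typed shape. -/
theorem towerReductionAtTwo_holds : TowerReductionAtTwo :=
  fun _ hT => twoAdicWitness_of_towerUnitTwist hT

end Summit.BirchSwinnertonDyer.Rank1Residual.ManinAdditive.KatoCurve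

end
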